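/- Copyright: the b2b-balaban cell (near-miss cell 7), T⁴-continuum fan-out, NE7b crux team (2), leaf lineage
t4-ne7b-formalise-leaf-05 on the owner's INTERFACE REQUEST NE7b IR-41-7 (ii).  Released under the licence of the
surrounding project. -/
import Summits.QuantumFields.BalabanUV.T4Continuum.Support.HistoryGenealogyInstantiate
import Summits.QuantumFields.BalabanUV.T4Continuum.Support.HistoryRealiseMemory

/-!
# INSTANTIATION FROM THE LEVEL SETS, MEMORY-GENERIC PROCESS, part 1 (IR-41-7 (ii), brick 3-M): print's construction
of the large-field components with the readiness test made against an ARBITRARY memory function `Rm t k` — the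
M-twin of row S15's `HistoryGenealogyInstantiate` (`RunInput.St`), whose frozen memory `R t` is the instance
`Rm t _ := R t`; print's current memory is the instance `Rm t k := R (t + k)` (INTERFACE REQUEST NE7b IR-41-7 (ii) of
the row-NE7b OWNER t4-ne7b-p1 gen 41, HOME/INBOX.md; ruling R-OWNER-41-1 on the located model finding
F-ne7bleaf01g24-1; filed by leaf lineage t4-ne7b-formalise-leaf-05 — PRE-POSITIONING ONLY)

Summits-side support leaf of the T⁴-continuum cell (rung (B)+1 on a FINITE torus only; NOT infinite volume, NOT the
mass gap, NOT the Clay statement; NOT a proof of the spine estimate NE7b, which is the cell's OWN estimate, NOT PRINTED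
and NOT PROVED).  [folklore] finite combinatorics in the ℤᵈ index model over row S15 brick 3 (`Line`, `lab`, `toLab`,
`RunInput` with `NewOK`, `Fld`, `P`, `domL`, `P_eq_imgC` — REUSED, not re-declared), brick 2 `HistoryTouchComponents`
(`tcomps`, `fam_disjoint_of_ne`, `exists_chainTouch_enum_of_mem_tcomps`), row S13∕S13-R (`ComponentHistory`), row S14
(`Lab`, `imgC`, `ChainTouch`) and leaf-01's IR-41-2 `HistoryRealiseMemory` (`StopsM`); nothing printed is asserted, no
`def … : Prop` fact of Bałaban's, no cite-tagged hypothesis, zero `sorry`.  B16 = [Balaban1989LargeFieldII] pp. 383–387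
and B15 = [Balaban1989LargeFieldI] pp. 177, 198 are manuscripts UNDER AUDIT; the construction is OUR READING of their
rules turned into a definition (locators in row S15's field docstrings, C-B16-6).

THE ONE CHANGE w.r.t. row S15.  `RunInputM d` = `RunInput d` + a memory function `Rm : ℕ → ℕ → ℕ`; a line with last
event `t` is READY at level `j` iff `StopsM L s Rm t E (j − t)` — condition (ii) tested with the memory `Rm t (j − t)`
(print: «with N = R_j» at the level the test is made, B16 p. 384; «in some steps the number R_k decreases by the factor
L^{−1}», B15 p. 177) — instead of S15's frozen `Stops L s R t E (j − t)` (memory `R t`).  Everything downstream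
(`AliveM`, `RnwM`, `vertM`, `blocksM`, `loneOldM`, `newLineM`, `formM`, `StM`, `PrevM`, `enumBM`, `histM`, `rnwM`) is
row S15's text with `Rdy ↦ RdyM`, nothing else changed; the sizes `R` keep their other role (the restart memory of the
windows `dictW R n₁`, untouched).

WHAT IS DEFINED AND PROVED (names as requested in IR-41-7 (ii)).  **`RunInputM`**, **`RdyM`**, `AliveM`, `RnwM`,
`vertM`, `blocksM`, `loneOldM`, `newLineM`, `formM`, **`StM`**, `PrevM`, `enumBM`, **`histM : ComponentHistory (Lab d)`**,
**`rnwM`**; lemmas `StM_eq_formM`, `mem_StM_iff`, `lab_newLineM`, **`StM_nonempty_disjoint`**, `newLineM_injOn`,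
`lab_injOn_StM`, `constit_lab_newLineM`, `constitM_eq_nil`, `mem_compM_iff`, `enumBM_spec`; `rdyM_frozen_iff` (the
S15 instance).  Siblings: `…InstantiateMWF` (`wf_histM`), `…InstantiateMClauses` (`levelClausesW_histM`,
`realisesW_histM`, `disjoint_orbits_histM`), `…InstantiateMSanity`.

HONEST.  Proves nothing of Bałaban's; NE7b NOT proved; spine 0∕9.  HONEST DEPENDENCY (cell): continuum YM on T⁴ ⇐
BetaPertH ∧ nine spine estimates (0/9 proved); BetaPertH ⇐ (D1) ∧ (D4) ∧ CAP+tail; G-an2-4 gates asym, D1 and NE2/3/4.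
This file changes none of it. -/

open Finset
open Literature.MathematicalPhysics.QuantumFieldTheory.Balaban1983to89
open Literature.MathematicalPhysics.QuantumFieldTheory.Balaban1983to89.B13ScaleTransfer
open Literature.MathematicalPhysics.QuantumFieldTheory.Balaban1983to89.TreeLength
open Literature.MathematicalPhysics.QuantumFieldTheory.Balaban1983to89.B16SProfile
open Literature.MathematicalPhysics.QuantumFieldTheory.Balaban1983to89.B16MergeGeometry
open Summit.QuantumFields.BalabanUV.T4Continuum.HistoryRealise
open Summit.QuantumFields.BalabanUV.T4Continuum.HistoryRealiseMemory
open Summit.QuantumFields.BalabanUV.T4Continuum.HistoryGenealogyExtraction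
open Summit.QuantumFields.BalabanUV.T4Continuum.HistoryGenealogyRealise
open Summit.QuantumFields.BalabanUV.T4Continuum.HistoryTouchComponents

namespace Summit.QuantumFields.BalabanUV.T4Continuum.HistoryGenealogyInstantiate

noncomputable section

open Classical

variable {d : ℕ}

/-! ## §1 Input with a memory function, readiness against it, and the level step -/

/-- **THE INPUT OF A RUN WITH A READINESS MEMORY**: row S15's `RunInput` (flow `L`, `s`, sizes `R`, new regions `N`
with classes `cls`, new-field cubes `F`) plus a memory function `Rm t k` = the memory of condition (ii) used when a
line with last event `t` is tested at the relative index `k` (print: `R (t + k)`; the landed S15 process: `R t`).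
[folklore] -/
structure RunInputM (d : ℕ) extends RunInput d where
  /-- memory of condition (ii) for a line with last event `t`, tested at relative index `k` -/
  Rm : ℕ → ℕ → ℕ

namespace RunInputM

variable (I : RunInputM d)

/-- READY at level `j`, memory-generic: the orbit of the last-event domain stops at the relative index `j − t` for the
memory `Rm t (j − t)` (`HistoryRealiseMemory.StopsM`) [folklore] -/
def RdyM (j : ℕ) (τ : Line d) : Prop := StopsM I.L I.s I.Rm τ.t τ.E (j - τ.t)

/-- the frozen instance: with `Rm t _ := R t` readiness is row S15's `Rdy` [folklore] -/
theorem rdyM_frozen_iff (J : RunInput d) (j : ℕ) (τ : Line d) :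
    (RunInputM.mk J fun t _ => J.R t).RdyM j τ ↔ J.Rdy j τ := Iff.rfl

/-- ALIVE after the 𝐑-operation of level `j`: unready, or with a new field (the ready clean ones are integrated)
[folklore] -/
def AliveM (j : ℕ) (τ : Line d) : Prop := ¬ I.RdyM j τ ∨ I.Fld j τ

/-- RENEWED by the 𝐑-operation of level `j`: ready with a new field [folklore] -/
def RnwM (j : ℕ) (τ : Line d) : Prop := I.RdyM j τ ∧ I.Fld j τ

/-- a renewed line is alive [folklore] -/
theorem aliveM_of_rnwM {j : ℕ} {τ : Line d} (h : I.RnwM j τ) : I.AliveM j τ := Or.inr h.2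

/-- an alive unrenewed line is unready [folklore] -/
theorem not_rdyM_of_aliveM_not_rnwM {j : ℕ} {τ : Line d} (ha : I.AliveM j τ) (hr : ¬ I.RnwM j τ) : ¬ I.RdyM j τ :=
  fun hR => ha.elim (fun h => h hR) fun hF => hr ⟨hR, hF⟩

/-- the VERTICES at level `ℓ`: the alive lines of the previous level and the new regions of level `ℓ` [folklore] -/
def vertM (ℓ : ℕ) (prev : Finset (Line d)) : Finset (Line d ⊕ Lab d) :=
  (prev.filter (I.AliveM (ℓ - 1))).image Sum.inl ∪ (I.N ℓ).image Sum.inr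

/-- membership of an old vertex [folklore] -/
theorem inl_mem_vertM {ℓ : ℕ} {prev : Finset (Line d)} {τ : Line d} :
    Sum.inl τ ∈ I.vertM ℓ prev ↔ τ ∈ prev ∧ I.AliveM (ℓ - 1) τ := by
  simp [vertM]

/-- membership of a new vertex [folklore] -/
theorem inr_mem_vertM {ℓ : ℕ} {prev : Finset (Line d)} {n : Lab d} : Sum.inr n ∈ I.vertM ℓ prev ↔ n ∈ I.N ℓ := by
  simp [vertM]

/-- the BLOCKS (components) at level `ℓ` [folklore] -/
def blocksM (ℓ : ℕ) (prev : Finset (Line d)) : Finset (Finset (Line d ⊕ Lab d)) := tcomps (I.P ℓ) (I.vertM ℓ prev)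

/-- the lone UNRENEWED old line of a block, if the block is one [folklore] -/
def loneOldM (ℓ : ℕ) (T : Finset (Line d ⊕ Lab d)) : Option (Line d) :=
  if h : ∃ τ, T = {Sum.inl τ} ∧ ¬ I.RnwM (ℓ - 1) τ then some (Classical.choose h) else none

/-- `loneOldM` of a lone unrenewed old line [folklore] -/
theorem loneOldM_singleton {ℓ : ℕ} {τ : Line d} (h : ¬ I.RnwM (ℓ - 1) τ) : I.loneOldM ℓ {Sum.inl τ} = some τ := by
  have hex : ∃ τ', ({Sum.inl τ} : Finset (Line d ⊕ Lab d)) = {Sum.inl τ'} ∧ ¬ I.RnwM (ℓ - 1) τ' := ⟨τ, rfl, h⟩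
  rw [loneOldM, dif_pos hex]
  have hspec := (Classical.choose_spec hex).1
  have h1 : τ = Classical.choose hex := Sum.inl_injective (Finset.singleton_inj.1 hspec)
  rw [← h1]

/-- `loneOldM T = some τ` forces the block [folklore] -/
theorem eq_of_loneOldM_eq_some {ℓ : ℕ} {T : Finset (Line d ⊕ Lab d)} {τ : Line d} (h : I.loneOldM ℓ T = some τ) :
    T = {Sum.inl τ} ∧ ¬ I.RnwM (ℓ - 1) τ := by
  unfold loneOldM at h
  split_ifs at h with hex
  rw [Option.some.injEq] at h
  subst h
  exact Classical.choose_spec hex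

/-- **THE NEW LINE of a block**: domain = the union of the block's images; `(t, E)` inherited iff the block is a lone
unrenewed old line, else the event values `(ℓ, domain)`. [folklore] -/
def newLineM (ℓ : ℕ) (T : Finset (Line d ⊕ Lab d)) : Line d :=
  match I.loneOldM ℓ T with
  | some τ => ⟨fam (I.P ℓ) T, τ.t, τ.E⟩
  | none => ⟨fam (I.P ℓ) T, ℓ, fam (I.P ℓ) T⟩

/-- the new line's domain is the union of the block's images [folklore] -/
@[simp] theorem newLineM_D (ℓ : ℕ) (T : Finset (Line d ⊕ Lab d)) : (I.newLineM ℓ T).D = fam (I.P ℓ) T := by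
  unfold newLineM; split <;> rfl

/-- its label [folklore] -/
theorem lab_newLineM (ℓ : ℕ) (T : Finset (Line d ⊕ Lab d)) : lab (I.newLineM ℓ T) = ((fun _ => 0 : Pt d), fam (I.P ℓ) T) := by
  simp [lab]

/-- the lines FORMED at level `ℓ` from the previous lines [folklore] -/
def formM (ℓ : ℕ) (prev : Finset (Line d)) : Finset (Line d) := (I.blocksM ℓ prev).image (I.newLineM ℓ)

/-- **THE LIVE LINES AT LEVEL `ℓ`** (the process). [folklore] -/
def StM : ℕ → Finset (Line d)
  | 0 => I.formM 0 ∅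
  | ℓ + 1 => I.formM (ℓ + 1) (StM ℓ)

/-- the previous level's lines (none before level `0`) [folklore] -/
def PrevM : ℕ → Finset (Line d)
  | 0 => ∅
  | ℓ + 1 => I.StM ℓ

/-- the process equation, uniformly in `ℓ` [folklore] -/
theorem StM_eq_formM (ℓ : ℕ) : I.StM ℓ = I.formM ℓ (I.PrevM ℓ) := by
  cases ℓ <;> rfl

/-- membership in the live lines [folklore] -/
theorem mem_StM_iff {ℓ : ℕ} {τ : Line d} : τ ∈ I.StM ℓ ↔ ∃ T ∈ I.blocksM ℓ (I.PrevM ℓ), I.newLineM ℓ T = τ := by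
  rw [StM_eq_formM, formM, Finset.mem_image]

/-- a CHOSEN leaf-first enumeration of a block (brick 2 + brick 1) [folklore] -/
def enumBM (ℓ : ℕ) (prev : Finset (Line d)) (T : Finset (Line d ⊕ Lab d)) : List (Line d ⊕ Lab d) :=
  if hT : T ∈ I.blocksM ℓ prev then Classical.choose (exists_chainTouch_enum_of_mem_tcomps hT) else []

/-- its specification [folklore] -/
theorem enumBM_spec {ℓ : ℕ} {prev : Finset (Line d)} {T : Finset (Line d ⊕ Lab d)} (hT : T ∈ I.blocksM ℓ prev) :
    (I.enumBM ℓ prev T).Nodup ∧ (∀ x, x ∈ I.enumBM ℓ prev T ↔ x ∈ T) ∧ ChainTouch ((I.enumBM ℓ prev T).map (I.P ℓ)) := by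
  rw [enumBM, dif_pos hT]
  obtain ⟨h1, h2, h3⟩ := Classical.choose_spec (exists_chainTouch_enum_of_mem_tcomps hT)
  refine ⟨h1, fun x => ?_, h3⟩
  simpa only [List.mem_toFinset] using Finset.ext_iff.1 h2 x

/-- **THE EXTRACTED COMPONENT BOOKKEEPING**: components = labels of the live lines; constituents of a component = the
labelled enumeration of its block; new regions = `N`; classes = `cls`; the per-component flag `fieldIn` of row S13 is
NOT used (renewal is per part, `rnwM`). [folklore] -/
def histM : ComponentHistory (Lab d) where
  comp ℓ := (I.StM ℓ).image lab
  newReg := I.N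
  cls := I.cls
  constit ℓ c :=
    if h : ∃ T ∈ I.blocksM ℓ (I.PrevM ℓ), lab (I.newLineM ℓ T) = c then
      (I.enumBM ℓ (I.PrevM ℓ) (Classical.choose h)).map toLab
    else []
  fieldIn _ _ := false

/-- **THE PER-PART RENEWAL FLAGS**: the line labelled `p` at level `j` is renewed by the 𝐑-operation of level `j`.
[folklore] -/
def rnwM (j : ℕ) (p : Lab d) : Bool := decide (∃ τ ∈ I.StM j, lab τ = p ∧ I.RnwM j τ)

/-! ## §2 Nonempty, pairwise disjoint live domains -/

/-- under `NewOK` every vertex image is nonempty, given nonempty previous domains [folklore] -/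
theorem P_nonempty_vertsM (hN : I.NewOK) {ℓ : ℕ} {prev : Finset (Line d)} (hprev : ∀ τ ∈ prev, τ.D.Nonempty) :
    ∀ v ∈ I.vertM ℓ prev, (I.P ℓ v).Nonempty := by
  intro v hv
  cases v with
  | inl τ => exact Sop_nonempty _ (hprev τ ((I.inl_mem_vertM).1 hv).1)
  | inr n =>
      have hn := (I.inr_mem_vertM).1 hv
      exact ⟨n.1, (hN.ok ℓ n hn).1⟩

/-- **LIVE DOMAINS ARE NONEMPTY AND PAIRWISE DISJOINT** (under `NewOK`). [folklore] -/
theorem StM_nonempty_disjoint (hN : I.NewOK) : ∀ ℓ : ℕ,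
    (∀ τ ∈ I.StM ℓ, τ.D.Nonempty) ∧ (∀ τ ∈ I.StM ℓ, ∀ τ' ∈ I.StM ℓ, τ ≠ τ' → Disjoint τ.D τ'.D) := by
  -- one step, from any previous family with nonempty domains
  have step : ∀ ℓ prev, (∀ τ ∈ prev, τ.D.Nonempty) →
      (∀ τ ∈ I.formM ℓ prev, τ.D.Nonempty) ∧
        (∀ τ ∈ I.formM ℓ prev, ∀ τ' ∈ I.formM ℓ prev, τ ≠ τ' → Disjoint τ.D τ'.D) := by
    intro ℓ prev hprev
    have hPne := I.P_nonempty_vertsM hN (ℓ := ℓ) hprev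
    constructor
    · intro τ hτ
      obtain ⟨T, hT, rfl⟩ := Finset.mem_image.1 hτ
      rw [newLineM_D]
      exact fam_nonempty_of_mem_tcomps hT hPne
    · intro τ hτ τ' hτ' hne
      obtain ⟨T, hT, rfl⟩ := Finset.mem_image.1 hτ
      obtain ⟨T', hT', rfl⟩ := Finset.mem_image.1 hτ'
      have hTT : T ≠ T' := fun h => hne (by rw [h])
      rw [newLineM_D, newLineM_D]
      exact fam_disjoint_of_ne hT hT' hTT
  intro ℓ
  induction ℓ with
  | zero => rw [StM_eq_formM]; exact step 0 ∅ (by simp)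
  | succ ℓ ih => rw [StM_eq_formM]; exact step (ℓ + 1) (I.StM ℓ) ih.1

/-- every vertex image at level `ℓ` is nonempty (under `NewOK`) [folklore] -/
theorem P_nonempty_vertM (hN : I.NewOK) (ℓ : ℕ) : ∀ v ∈ I.vertM ℓ (I.PrevM ℓ), (I.P ℓ v).Nonempty := by
  refine I.P_nonempty_vertsM hN fun τ hτ => ?_
  cases ℓ with
  | zero => simp [PrevM] at hτ
  | succ ℓ => exact (I.StM_nonempty_disjoint hN ℓ).1 τ hτ

/-- **`newLineM` IS INJECTIVE ON THE BLOCKS** (distinct blocksM have different unions). [folklore] -/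
theorem newLineM_injOn (hN : I.NewOK) (ℓ : ℕ) {T T' : Finset (Line d ⊕ Lab d)} (hT : T ∈ I.blocksM ℓ (I.PrevM ℓ))
    (hT' : T' ∈ I.blocksM ℓ (I.PrevM ℓ)) (h : lab (I.newLineM ℓ T) = lab (I.newLineM ℓ T')) : T = T' := by
  by_contra hne
  rw [lab_eq_iff, newLineM_D, newLineM_D] at h
  exact fam_ne_of_ne hT hT' hne (I.P_nonempty_vertM hN ℓ) h

/-- distinct live lines have distinct labels (under `NewOK`) [folklore] -/
theorem lab_injOn_StM (hN : I.NewOK) (ℓ : ℕ) {τ τ' : Line d} (hτ : τ ∈ I.StM ℓ) (hτ' : τ' ∈ I.StM ℓ)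
    (h : lab τ = lab τ') : τ = τ' := by
  by_contra hne
  obtain ⟨x, hx⟩ := (I.StM_nonempty_disjoint hN ℓ).1 τ hτ
  rw [lab_eq_iff] at h
  exact Finset.disjoint_left.1 ((I.StM_nonempty_disjoint hN ℓ).2 τ hτ τ' hτ' hne) hx (h ▸ hx)

/-! ## §3 The constituent list of a component is the enumeration of its block -/

/-- **THE CONSTITUENTS OF THE COMPONENT OF A BLOCK** are the labelled leaf-first enumeration of that block
(under `NewOK`). [folklore] -/
theorem constit_lab_newLineM (hN : I.NewOK) {ℓ : ℕ} {T : Finset (Line d ⊕ Lab d)} (hT : T ∈ I.blocksM ℓ (I.PrevM ℓ)) :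
    I.histM.constit ℓ (lab (I.newLineM ℓ T)) = (I.enumBM ℓ (I.PrevM ℓ) T).map toLab := by
  have hex : ∃ T' ∈ I.blocksM ℓ (I.PrevM ℓ), lab (I.newLineM ℓ T') = lab (I.newLineM ℓ T) := ⟨T, hT, rfl⟩
  show (if h : ∃ T' ∈ I.blocksM ℓ (I.PrevM ℓ), lab (I.newLineM ℓ T') = lab (I.newLineM ℓ T) then
      (I.enumBM ℓ (I.PrevM ℓ) (Classical.choose h)).map toLab else []) = _
  rw [dif_pos hex]
  obtain ⟨hT', hlab⟩ := Classical.choose_spec hex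
  rw [I.newLineM_injOn hN ℓ hT' hT hlab]

/-- constituents of a non-component are empty [folklore] -/
theorem constitM_eq_nil {ℓ : ℕ} {c : Lab d} (h : ¬ ∃ T ∈ I.blocksM ℓ (I.PrevM ℓ), lab (I.newLineM ℓ T) = c) :
    I.histM.constit ℓ c = [] := by
  show (if h : ∃ T ∈ I.blocksM ℓ (I.PrevM ℓ), lab (I.newLineM ℓ T) = c then
      (I.enumBM ℓ (I.PrevM ℓ) (Classical.choose h)).map toLab else []) = []
  rw [dif_neg h]

/-- membership in the components of the extracted bookkeeping [folklore] -/
theorem mem_compM_iff {ℓ : ℕ} {c : Lab d} : c ∈ I.histM.comp ℓ ↔ ∃ T ∈ I.blocksM ℓ (I.PrevM ℓ), lab (I.newLineM ℓ T) = c := by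
  show c ∈ (I.StM ℓ).image lab ↔ _
  simp only [Finset.mem_image, mem_StM_iff]
  constructor
  · rintro ⟨τ, ⟨T, hT, rfl⟩, rfl⟩; exact ⟨T, hT, rfl⟩
  · rintro ⟨T, hT, rfl⟩; exact ⟨I.newLineM ℓ T, ⟨T, hT, rfl⟩, rfl⟩


end RunInputM

end

end Summit.QuantumFields.BalabanUV.T4Continuum.HistoryGenealogyInstantiate
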